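import Summits.CriticalPhenomena.PercolationContinuityZ3.Theorems.FK.Transplant.FHSlabPercolation
import Summits.CriticalPhenomena.PercolationContinuityZ3.Theorems.FK.Transplant.FHDimension
import Summits.CriticalPhenomena.PercolationContinuityZ3.Theorems.FK.Transplant.FHSlabThresholdMono
import Summits.CriticalPhenomena.PercolationContinuityZ3.Theorems.FK.Transplant.FreeBoundaryTransplantR3
import Summits.CriticalPhenomena.PercolationContinuityZ3.Theorems.FK.Transplant.UFSC0FreeSlab
import Summits.CriticalPhenomena.PercolationContinuityZ3.Theorems.FK.ContinuityQOneBridge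
import Summits.CriticalPhenomena.PercolationContinuityZ3.Theorems.FK.CriticalPointBounds
import HarnessLib

/-!
# FRONTIER TRANSPLANT, binder 1 (FH) calibration — the hypothesis of record's OWN critical value
# `p_FH(q; d) := inf {p : FH d q p}`: pinned in the K1 interval `[p_c(q), p̂_c(q)]`, non-decreasing and
# `1/4`-Lipschitz in `q ≥ 1`, non-increasing in `d`, `= p_c` at `q = 1` (KN Lemma 9) and at `q = 2` under
# Bodineau's theorem; K1 for the LITERAL binders: `[FH ∧ TP_FK ∀ p ∈ (p_c(q), 1)] ⟹ p̂_c(q) = p_c(q)`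

Registered R98 (cell INBOX l.6738, 2026-08-24); registry row T1h; label T1h-A (coordinator fk-4 g200; the lead may restyle the label on its record line).
Support file (`--supports stmt-CriticalPhenomena-4575`, helper) of the FRONTIER TRANSPLANT sub-cell
(`fk-continuity/transplant/`, seat `prim-bschramm-fkt-p2`); builds on p205010 (kernel theorem, internal audit signed;
external expert review pending). No definitions, no named facts, no sorries; standard axioms. Sequel of the binder-1
calibration leaves `FHBernoulliWindow` (T1), `FHFreePercolation` (T1c), `FHBoundaryReach` (T1b), `FHSlabPercolation`
(T1s), `FHSlabThresholdMono` (T1q-A), `FHDimension` (T1w) and a consumer of K1-FIN (`UFSC0FreeSlab`, T4k-09).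

HONEST FRAMING (page 1, cell rule). The transplant's theorem of record `ufsc0_of_freeBoundaryHypothesis_r3`
(p248245, « 2 / 0 ☑ ») is CONDITIONAL on FH AND on TP_FK, both OPEN at the same `p` for `q > 1` near `p_c(q)`
(⇔ GRC Conj. (5.103) via K1; barrier note `Literature.Barriers.CriticalPhenomena.SamePFreeBoundaryCriteria`, FBN-01);
the transplant is a typed reduction, not a proof of FK continuity. THIS FILE DOES NOT CHANGE THAT. It locates the
`p`-threshold of binder 1 ITSELF: the set `{p ∈ [0,1] : FH d q p}` (written INLINE as
`{x : ℝ | ∃ p : unitInterval, ↑p = x ∧ FH d q p}`, called "the FH-set" in names; NO definition is introduced) is an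
up-set of `[0, 1]` (T1c `fh_mono_left`), so binder 1 is decided by ONE number `p_FH(q; d) := inf` FH-set (up to the
threshold point itself), and everything the tree knows UNCONDITIONALLY about binder 1 becomes a statement about it:
`p_c(q) ≤ p_FH(q; d) ≤ p̂_c(q)` (`d ≥ 3`; T1c + T1s), `p_FH(q; d) ≤ q·p_c(ℤ^d)/(1 + (q-1)·p_c(ℤ^d))` (`d ≥ 2`; T1),
`q ↦ p_FH(q; d)` non-decreasing ((3.22)) and `1/4`-Lipschitz ((3.23) via T1b's `fh_of_fh_ratio_le` and T1q-A's
abstract form of the proof of Grimmett's Thm. (5.5)/(5.10)) hence continuous on `[1, ∞)`, `d ↦ p_FH(q; d)`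
non-increasing (T1w), `p_FH(1; d) = p_c(ℤ^d)` (KN Lemma 9), `p_FH(2; d) = p_c(2)` under the displayed named fact
`Bodineau2005_slabThreshold` (FBN-01; NOT asserted), "binder 1 at every `p ∈ (p_c(q), 1)`" ⟺ `p_FH(q; d) = p_c(q)`
⟸ (5.103)_q, and `p_FH(q; d) - p_c(q) ≤ (q-1)/4`. Last, K1 in kernel form for the LITERAL binders of `_r3`: if FH AND
TP_FK hold at every `p ∈ (p_c(q), 1)` then `p̂_c(q) = p_c(q)` (`_r3` composed with K1-FIN's
`fkSlabCriticalProb_le_of_ufsc0`) — the record is CONSUMED, nothing about it is discharged. Which end point of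
`[p_c(q), p̂_c(q)]` (if either) `p_FH(q; d)` equals for `q ∉ {1, 2}` is exactly what is open; not a binder
discharge, not a re-cut, not `_r4`; `_r3` « 2 / 0 ☑ », n_open = 2, BINDER-OWNERS, FO-19 NO-GO unchanged.

## Contents (namespace `Summit.CriticalPhenomena.PercolationContinuityZ3.Theorems.FK`)

§1 the FH-set: `fhSet_subset_Icc`, `fhSet_nonempty`, `bddBelow_fhSet`, `mem_fhSet_of_le`, `csInf_insert_one_eq`,
`csInf_fhSet_mem_Icc_zero_one`, `csInf_fhSet_le_of_fh`, **`fh_of_csInf_fhSet_lt`**, `not_fh_of_lt_csInf_fhSet`.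
§2 the K1 interval: `rcCriticalProb_le_csInf_fhSet`, `csInf_fhSet_le_fkSlabCriticalProb`, **`csInf_fhSet_mem_Icc`**,
`csInf_fhSet_le_ratio_criticalProb`.
§3 in `q`: **`csInf_fhSet_mono`**, `csInf_fhSet_le_ratio_of_le`, `csInf_fhSet_sub_le_div`, **`abs_csInf_fhSet_sub_le`**,
**`lipschitzOnWith_csInf_fhSet`**, `continuousOn_csInf_fhSet`.
§4 special values and `d`: **`csInf_fhSet_one_eq_criticalProb`**, `csInf_fhSet_one_eq_rcCriticalProb`,
`csInf_fhSet_le_criticalProb_add`, `csInf_fhSet_sub_rcCriticalProb_le`, **`csInf_fhSet_two_eq_of_bodineau`**,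
**`csInf_fhSet_anti_dim`**.
§5 K1: **`forall_fh_iff_csInf_fhSet_eq`**, `csInf_fhSet_eq_of_slabThreshold_eq`,
**`slabThreshold_eq_of_forall_fh_targetHittable`**.

## References

* G. Grimmett, *The Random-Cluster Model*, Springer 2006: Thm. (3.21) eqs. (3.22)/(3.23); Thm. (5.5)–(5.10) and their
  proofs (pp. 99–101); §5.7 eq. (5.102), Conj. (5.103), Thm. (5.104). [Grimmett2006]
* G. Kozma, S. Nitzan, arXiv:2401.12397 (2024), §4 p. 16 (hittable geometry), Lemma 9, Theorem 6. [KozmaNitzan2024]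
* T. Bodineau, *Slab percolation for the Ising model*, PTRF 132 (2005) 83–118, Thm. 1.1. [Bodineau2005]
-/

noncomputable section

open scoped Classical NNReal
open Filter Topology MeasureTheory

namespace Summit.CriticalPhenomena.PercolationContinuityZ3.Theorems.FK

open Literature.Probability.Percolation Literature.Probability.LatticeModels SimpleGraph
open Literature.Probability.Percolation.KozmaNitzan Literature.Barriers.CriticalPhenomena

variable {d : ℕ}

/-! ### 1. The FH-set `{p ∈ [0,1] : FH d q p}` (inline) and its infimum `p_FH(q; d)` -/

section FHSet

variable {q : ℝ}

/-- The FH-set lies in `[0, 1]`. [folklore] -/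
theorem fhSet_subset_Icc (d : ℕ) (q : ℝ) :
    {x : ℝ | ∃ p : unitInterval, (p : ℝ) = x ∧ FH d q p} ⊆ Set.Icc (0 : ℝ) 1 := by
  rintro x ⟨p, rfl, -⟩
  exact p.2

/-- The FH-set is non-empty for `d ≥ 2`, `q ≥ 1` (T1 `exists_fh`: the Bernoulli window).
[cite: Grimmett2006, Thm. (3.21), eq. (3.23); KozmaNitzan2024, §4 Lemma 9 (p. 16)] -/
theorem fhSet_nonempty (hd : 2 ≤ d) (hq : 1 ≤ q) :
    {x : ℝ | ∃ p : unitInterval, (p : ℝ) = x ∧ FH d q p}.Nonempty := by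
  obtain ⟨p, -, hp⟩ := exists_fh hd hq
  exact ⟨p, p, rfl, hp⟩

/-- The FH-set is bounded below (by `0`). [folklore] -/
theorem bddBelow_fhSet (d : ℕ) (q : ℝ) : BddBelow {x : ℝ | ∃ p : unitInterval, (p : ℝ) = x ∧ FH d q p} :=
  ⟨0, fun _ hx => (fhSet_subset_Icc d q hx).1⟩

/-- **The FH-set is an up-set of `[0, 1]`** (`q ≥ 1`; T1c `fh_mono_left`, (3.22) in `p`).
[cite: Grimmett2006, Thm. (3.21), eq. (3.22); KozmaNitzan2024, §4 Lemma 9 (p. 16)] -/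
theorem mem_fhSet_of_le (hq : 1 ≤ q) {x y : ℝ} (hx : x ∈ {x : ℝ | ∃ p : unitInterval, (p : ℝ) = x ∧ FH d q p})
    (hy : y ∈ Set.Icc (0 : ℝ) 1) (hxy : x ≤ y) : y ∈ {x : ℝ | ∃ p : unitInterval, (p : ℝ) = x ∧ FH d q p} := by
  obtain ⟨p, rfl, hp⟩ := hx
  exact ⟨⟨y, hy⟩, rfl, fh_mono_left hq (show p ≤ ⟨y, hy⟩ from hxy) hp⟩

/-- Adjoining the point `1` to a non-empty subset of `[0, 1]` does not change its infimum. [folklore] -/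
theorem csInf_insert_one_eq {S : Set ℝ} (hS : S ⊆ Set.Icc (0 : ℝ) 1) (hne : S.Nonempty) :
    sInf (insert 1 S) = sInf S := by
  have hbdd : BddBelow S := ⟨0, fun _ hx => (hS hx).1⟩
  rw [csInf_insert hbdd hne]
  obtain ⟨x, hx⟩ := hne
  exact min_eq_right ((csInf_le hbdd hx).trans (hS hx).2)

/-- `p_FH(q; d) ∈ [0, 1]` (`d ≥ 2`, `q ≥ 1`). [folklore] -/
theorem csInf_fhSet_mem_Icc_zero_one (hd : 2 ≤ d) (hq : 1 ≤ q) :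
    sInf {x : ℝ | ∃ p : unitInterval, (p : ℝ) = x ∧ FH d q p} ∈ Set.Icc (0 : ℝ) 1 := by
  obtain ⟨x, hx⟩ := fhSet_nonempty hd hq
  exact ⟨le_csInf ⟨x, hx⟩ fun _ hy => (fhSet_subset_Icc d q hy).1,
    (csInf_le (bddBelow_fhSet d q) hx).trans (fhSet_subset_Icc d q hx).2⟩

/-- Binder 1 at `p` puts `p_FH(q; d) ≤ p`. [folklore] -/
theorem csInf_fhSet_le_of_fh {p : unitInterval} (h : FH d q p) :
    sInf {x : ℝ | ∃ p : unitInterval, (p : ℝ) = x ∧ FH d q p} ≤ (p : ℝ) :=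
  csInf_le (bddBelow_fhSet d q) ⟨p, rfl, h⟩

/-- **Binder 1 holds at every `p > p_FH(q; d)`** (`d ≥ 2`, `q ≥ 1`): the FH-set is an up-set, so binder 1 is decided
by the single number `p_FH(q; d)` (up to the threshold point itself). [cite: Grimmett2006, Thm. (3.21), eq. (3.22); KozmaNitzan2024, §4 Lemma 9 (p. 16)] -/
theorem fh_of_csInf_fhSet_lt (hd : 2 ≤ d) (hq : 1 ≤ q) {p : unitInterval}
    (h : sInf {x : ℝ | ∃ p : unitInterval, (p : ℝ) = x ∧ FH d q p} < (p : ℝ)) : FH d q p := by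
  obtain ⟨x, ⟨p₀, rfl, hp₀⟩, hlt⟩ := exists_lt_of_csInf_lt (fhSet_nonempty hd hq) h
  exact fh_mono_left hq (show p₀ ≤ p from hlt.le) hp₀

/-- Binder 1 fails at every `p < p_FH(q; d)`. [folklore] -/
theorem not_fh_of_lt_csInf_fhSet {p : unitInterval}
    (h : (p : ℝ) < sInf {x : ℝ | ∃ p : unitInterval, (p : ℝ) = x ∧ FH d q p}) : ¬ FH d q p :=
  fun hp => (csInf_fhSet_le_of_fh hp).not_gt h

end FHSet

/-! ### 2. `p_FH(q; d)` lies in the K1 interval `[p_c(q), p̂_c(q)]` -/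

section K1Interval

variable {q : ℝ}

/-- **`p_c(q) ≤ p_FH(q; d)`** (`d ≥ 2`, `q ≥ 1`): binder 1 forces `θ⁰(p, q) > 0` (T1c `rcCriticalProb_le_of_fh`).
[cite: Grimmett2006, §5.1 eq. (5.1)–(5.3), Conj. (5.103); KozmaNitzan2024, §4 Lemma 9 (p. 16)] -/
theorem rcCriticalProb_le_csInf_fhSet (hd : 2 ≤ d) (hq : 1 ≤ q) :
    rcCriticalProb d q ≤ sInf {x : ℝ | ∃ p : unitInterval, (p : ℝ) = x ∧ FH d q p} := by
  haveI : NeZero d := ⟨by omega⟩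
  refine le_csInf (fhSet_nonempty hd hq) ?_
  rintro x ⟨p, rfl, hp⟩
  exact rcCriticalProb_le_of_fh hq hp

/-- **`p_FH(q; d) ≤ p̂_c(q)`** (`d ≥ 3`, `q ≥ 1`): binder 1 holds above FBN-01's slab threshold (T1s
`fh_of_fkSlabCriticalProb_lt`) and `p̂_c(q) < 1` (T1t). [cite: Grimmett2006, §5.7 eq. (5.102), Conj. (5.103); KozmaNitzan2024, §4 Lemma 9 (p. 16)] -/
theorem csInf_fhSet_le_fkSlabCriticalProb (hd : 3 ≤ d) (hq : 1 ≤ q) :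
    sInf {x : ℝ | ∃ p : unitInterval, (p : ℝ) = x ∧ FH d q p} ≤ fkSlabCriticalProb d q := by
  have hq0 : 0 < q := one_pos.trans_le hq
  refine le_of_forall_gt_imp_ge_of_dense fun z hz => ?_
  obtain ⟨x, hx, hxz⟩ := exists_between (lt_min hz (fkSlabCriticalProb_lt_one (d := d) (by omega) hq))
  have hx0 : 0 ≤ x := (fkSlabCriticalProb_mem_Icc (d := d) hq0).1.trans hx.le
  have hx1 : x ≤ 1 := (hxz.trans_le (min_le_right _ _)).le
  exact (csInf_fhSet_le_of_fh (fh_of_fkSlabCriticalProb_lt hd hq (p := ⟨x, hx0, hx1⟩) hx)).trans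
    (hxz.le.trans (min_le_left _ _))

/-- **Binder 1's critical value is pinned in the K1 interval: `p_FH(q; d) ∈ [p_c(q), p̂_c(q)]`** (`d ≥ 3`, `q ≥ 1`).
The interval's length is Conjecture (5.103)'s defect (`0` in print for `q ∈ {1, 2}`); which end point (if either)
`p_FH` equals for other `q` is the open content of binder 1. [cite: Grimmett2006, §5.7 eq. (5.102), Conj. (5.103); KozmaNitzan2024, §4 Lemma 9 (p. 16)] -/
theorem csInf_fhSet_mem_Icc (hd : 3 ≤ d) (hq : 1 ≤ q) :
    sInf {x : ℝ | ∃ p : unitInterval, (p : ℝ) = x ∧ FH d q p} ∈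
      Set.Icc (rcCriticalProb d q) (fkSlabCriticalProb d q) :=
  ⟨rcCriticalProb_le_csInf_fhSet (by omega) hq, csInf_fhSet_le_fkSlabCriticalProb hd hq⟩

/-- **T1's window as a bound on the critical value: `p_FH(q; d) ≤ q·p_c(ℤ^d)/(1 + (q-1)·p_c(ℤ^d))`** (`d ≥ 2`,
`q ≥ 1`; the (3.23)-conjugate of `p_c(ℤ^d)`, T1 `fh_of_threshold_lt`). [cite: Grimmett2006, Thm. (3.21), eq. (3.23), eq. (5.8); KozmaNitzan2024, §4 Lemma 9 (p. 16)] -/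
theorem csInf_fhSet_le_ratio_criticalProb (hd : 2 ≤ d) (hq : 1 ≤ q) :
    sInf {x : ℝ | ∃ p : unitInterval, (p : ℝ) = x ∧ FH d q p} ≤
      q * criticalProb (zdGraph d) 0 / (1 + (q - 1) * criticalProb (zdGraph d) 0) := by
  set c := criticalProb (zdGraph d) 0 with hc_def
  have hc : c ∈ Set.Icc (0 : ℝ) 1 := criticalProb_mem_Icc (zdGraph d) 0
  have hc1 : c < 1 := criticalProb_zd_lt_one hd
  have hden : 0 < 1 + (q - 1) * c := by nlinarith [hc.1]
  have hT1 : q * c / (1 + (q - 1) * c) < 1 := by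
    rw [div_lt_one hden]
    nlinarith [hc.1]
  have hT0 : 0 ≤ q * c / (1 + (q - 1) * c) := div_nonneg (by nlinarith [hc.1]) hden.le
  refine le_of_forall_gt_imp_ge_of_dense fun z hz => ?_
  obtain ⟨x, hx, hxz⟩ := exists_between (lt_min hz hT1)
  have hx0 : 0 ≤ x := hT0.trans hx.le
  have hx1 : x < 1 := hxz.trans_le (min_le_right _ _)
  exact (csInf_fhSet_le_of_fh (fh_of_threshold_lt hd hq ⟨x, hx0, hx1.le⟩ hx1 hx)).trans
    (hxz.le.trans (min_le_left _ _))

end K1Interval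

/-! ### 3. `q ↦ p_FH(q; d)` is non-decreasing and `1/4`-Lipschitz on `[1, ∞)` -/

section InQ

/-- **`p_FH` is non-decreasing in `q`**: `1 ≤ q ≤ q' ⟹ p_FH(q; d) ≤ p_FH(q'; d)` (`d ≥ 2`; the FH-set shrinks as `q`
grows, T1 `fh_anti_right`, (3.22)). [cite: Grimmett2006, Thm. (3.21), eq. (3.22), Thm. (5.5)] -/
theorem csInf_fhSet_mono (hd : 2 ≤ d) {q q' : ℝ} (hq : 1 ≤ q) (hqq' : q ≤ q') :
    sInf {x : ℝ | ∃ p : unitInterval, (p : ℝ) = x ∧ FH d q p} ≤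
      sInf {x : ℝ | ∃ p : unitInterval, (p : ℝ) = x ∧ FH d q' p} := by
  refine csInf_le_csInf (bddBelow_fhSet d q) (fhSet_nonempty hd (hq.trans hqq')) ?_
  rintro x ⟨p, rfl, hp⟩
  exact ⟨p, rfl, fh_anti_right hq hqq' hp⟩

/-- **(5.6), second inequality, for binder 1**: for `1 ≤ q' ≤ q`,
`p_FH(q; d) ≤ q·p_FH(q'; d)/(q' + (q - q')·p_FH(q'; d))` (`d ≥ 2`) — T1q-A's abstract `sInf_le_ratio_of_transfer`
fed with T1b's (3.23) transfer `fh_of_fh_ratio_le` (applied to the FH-sets with the point `1` adjoined, which changes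
no infimum). [cite: Grimmett2006, Thm. (5.5) (5.6) and its proof (p. 101); Thm. (3.21), eq. (3.23)] -/
theorem csInf_fhSet_le_ratio_of_le (hd : 2 ≤ d) {q q' : ℝ} (hq' : 1 ≤ q') (hq : q' ≤ q) :
    sInf {x : ℝ | ∃ p : unitInterval, (p : ℝ) = x ∧ FH d q p} ≤
      q * sInf {x : ℝ | ∃ p : unitInterval, (p : ℝ) = x ∧ FH d q' p} /
        (q' + (q - q') * sInf {x : ℝ | ∃ p : unitInterval, (p : ℝ) = x ∧ FH d q' p}) := by
  have hq1 : 1 ≤ q := hq'.trans hq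
  have hq0 : 0 < q := one_pos.trans_le hq1
  have key := sInf_le_ratio_of_transfer hq' hq
    (S := insert 1 {x : ℝ | ∃ p : unitInterval, (p : ℝ) = x ∧ FH d q p})
    (S' := insert 1 {x : ℝ | ∃ p : unitInterval, (p : ℝ) = x ∧ FH d q' p})
    (Set.insert_subset (Set.right_mem_Icc.2 zero_le_one) (fhSet_subset_Icc d q))
    (Set.insert_subset (Set.right_mem_Icc.2 zero_le_one) (fhSet_subset_Icc d q'))
    (Set.mem_insert _ _) (Set.mem_insert _ _)
    (fun p₀ p' hp₀ hp' hle => by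
      rcases Set.mem_insert_iff.1 hp₀ with h1 | hS
      · subst h1
        exact Set.mem_insert_iff.2 (Or.inl (le_antisymm hp'.2 hle))
      · exact Set.mem_insert_of_mem _ (mem_fhSet_of_le hq' hS hp' hle))
    (fun p p' hp hp' hcond hmem => by
      rcases Set.mem_insert_iff.1 hmem with h1 | hS
      · subst h1
        have h0 : q * (1 - p) ≤ 0 := by nlinarith [hcond, hp.1]
        have hp1 : 1 ≤ p := by nlinarith [h0, hq0]
        exact Set.mem_insert_iff.2 (Or.inl (le_antisymm hp.2 hp1))
      · obtain ⟨p₁, rfl, hp₁⟩ := hS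
        exact Set.mem_insert_of_mem _ ⟨⟨p, hp⟩, rfl, fh_of_fh_ratio_le hq' hq (p₁ := ⟨p, hp⟩) hcond hp₁⟩)
  rwa [csInf_insert_one_eq (fhSet_subset_Icc d q) (fhSet_nonempty hd hq1),
    csInf_insert_one_eq (fhSet_subset_Icc d q') (fhSet_nonempty hd hq')] at key

/-- **First display of the proof of Thm. (5.10) for binder 1**: for `1 ≤ q' ≤ q`,
`p_FH(q; d) - p_FH(q'; d) ≤ (q - q')/(4q')` (`d ≥ 2`). [cite: Grimmett2006, Thm. (5.10) (proof, p. 101)] -/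
theorem csInf_fhSet_sub_le_div (hd : 2 ≤ d) {q q' : ℝ} (hq' : 1 ≤ q') (hq : q' ≤ q) :
    sInf {x : ℝ | ∃ p : unitInterval, (p : ℝ) = x ∧ FH d q p} -
      sInf {x : ℝ | ∃ p : unitInterval, (p : ℝ) = x ∧ FH d q' p} ≤ (q - q') / (4 * q') :=
  sub_le_div_of_le_ratio hq' hq (csInf_fhSet_mem_Icc_zero_one hd hq') (csInf_fhSet_le_ratio_of_le hd hq' hq)

/-- **`|p_FH(q; d) - p_FH(q'; d)| ≤ |q - q'|/4` for `q, q' ≥ 1`** (`d ≥ 2`). [cite: Grimmett2006, Thm. (5.10) (proof, p. 101)] -/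
theorem abs_csInf_fhSet_sub_le (hd : 2 ≤ d) {q q' : ℝ} (hq : 1 ≤ q) (hq' : 1 ≤ q') :
    |sInf {x : ℝ | ∃ p : unitInterval, (p : ℝ) = x ∧ FH d q p} -
      sInf {x : ℝ | ∃ p : unitInterval, (p : ℝ) = x ∧ FH d q' p}| ≤ |q - q'| / 4 :=
  abs_sub_le_quarter_of (f := fun r => sInf {x : ℝ | ∃ p : unitInterval, (p : ℝ) = x ∧ FH d r p})
    (fun _ _ hr' hr => csInf_fhSet_mono hd hr' hr) (fun _ _ hr' hr => csInf_fhSet_sub_le_div hd hr' hr) hq hq'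

/-- **`q ↦ p_FH(q; d)` is `1/4`-Lipschitz on `[1, ∞)`** (`d ≥ 2`) — binder 1's critical value moves continuously
with the cluster weight, like `p_c(q)` (Thm. (5.10)) and `p̂_c(q)` (T1q-A). [cite: Grimmett2006, Thm. (5.10)] -/
theorem lipschitzOnWith_csInf_fhSet (hd : 2 ≤ d) :
    LipschitzOnWith (1 / 4 : ℝ≥0) (fun q => sInf {x : ℝ | ∃ p : unitInterval, (p : ℝ) = x ∧ FH d q p})
      (Set.Ici 1) :=
  lipschitzOnWith_quarter_of fun _ _ hq hq' => abs_csInf_fhSet_sub_le hd hq hq'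

/-- `q ↦ p_FH(q; d)` is continuous on `[1, ∞)` (`d ≥ 2`). [cite: Grimmett2006, Thm. (5.10)] -/
theorem continuousOn_csInf_fhSet (hd : 2 ≤ d) :
    ContinuousOn (fun q => sInf {x : ℝ | ∃ p : unitInterval, (p : ℝ) = x ∧ FH d q p}) (Set.Ici 1) :=
  (lipschitzOnWith_csInf_fhSet hd).continuousOn

end InQ

/-! ### 4. Special values: `q = 1` (KN Lemma 9), `q = 2` (Bodineau), and monotonicity in `d` -/

section Special

variable {q : ℝ}

/-- **`p_FH(1; d) = p_c(ℤ^d)`** (`d ≥ 2`): at `q = 1` binder 1 is KN Lemma 9 (`fh_one_of_theta_pos`: every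
`p ∈ (p_c, 1)` is in the FH-set) and `FH ⟹ θ > 0` (`p_c ≤ p_FH`). [cite: KozmaNitzan2024, §4 Lemma 9 (p. 16); Grimmett2006, §5.1 eq. (5.3)] -/
theorem csInf_fhSet_one_eq_criticalProb (hd : 2 ≤ d) :
    sInf {x : ℝ | ∃ p : unitInterval, (p : ℝ) = x ∧ FH d 1 p} = criticalProb (zdGraph d) 0 := by
  haveI : NeZero d := ⟨by omega⟩
  refine le_antisymm (le_of_forall_gt_imp_ge_of_dense fun z hz => ?_) ?_
  · obtain ⟨x, hx, hxz⟩ := exists_between (lt_min hz (criticalProb_zd_lt_one hd))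
    have hx0 : 0 ≤ x := (criticalProb_mem_Icc (zdGraph d) 0).1.trans hx.le
    have hx1 : x < 1 := hxz.trans_le (min_le_right _ _)
    have hFH : FH d 1 ⟨x, hx0, hx1.le⟩ :=
      fh_one_of_theta_pos hd ⟨x, hx0, hx1.le⟩ (theta_pos_of_criticalProb_lt_holds (zdGraph d) 0 _ hx) hx1
    exact (csInf_fhSet_le_of_fh hFH).trans (hxz.le.trans (min_le_left _ _))
  · rw [← rcCriticalProb_one_eq_criticalProb]
    exact rcCriticalProb_le_csInf_fhSet hd le_rfl

/-- `p_FH(1; d) = p_c(1)` (`d ≥ 2`; the random-cluster critical point at `q = 1`, FO-01's bridge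
`rcCriticalProb_one_eq_criticalProb`). [cite: KozmaNitzan2024, §4 Lemma 9 (p. 16); Grimmett2006, §5.1 eq. (5.3)] -/
theorem csInf_fhSet_one_eq_rcCriticalProb (hd : 2 ≤ d) :
    sInf {x : ℝ | ∃ p : unitInterval, (p : ℝ) = x ∧ FH d 1 p} = rcCriticalProb d 1 := by
  rw [csInf_fhSet_one_eq_criticalProb hd, rcCriticalProb_one_eq_criticalProb]

/-- **`p_FH(q; d) ≤ p_c(ℤ^d) + (q - 1)/4`** (`d ≥ 2`, `q ≥ 1`): the Lipschitz bound from `q' = 1`. So binder 1 holds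
at every `p > p_c(ℤ^d) + (q-1)/4` — as `q ↓ 1` the undecided regime of binder 1 shrinks to the point `p_c(ℤ^d)`.
[cite: Grimmett2006, Thm. (5.10) (proof, p. 101); KozmaNitzan2024, §4 Lemma 9 (p. 16)] -/
theorem csInf_fhSet_le_criticalProb_add (hd : 2 ≤ d) (hq : 1 ≤ q) :
    sInf {x : ℝ | ∃ p : unitInterval, (p : ℝ) = x ∧ FH d q p} ≤ criticalProb (zdGraph d) 0 + (q - 1) / 4 := by
  have h := csInf_fhSet_sub_le_div hd le_rfl hq
  rw [csInf_fhSet_one_eq_criticalProb hd] at h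
  linarith

/-- **Binder 1's defect is at most `(q - 1)/4`: `p_FH(q; d) - p_c(q) ≤ (q - 1)/4`** (`d ≥ 2`, `q ≥ 1`;
`p_c(ℤ^d) = p_c(1) ≤ p_c(q)`). [cite: Grimmett2006, Thm. (5.5), Thm. (5.10); KozmaNitzan2024, §4 Lemma 9 (p. 16)] -/
theorem csInf_fhSet_sub_rcCriticalProb_le (hd : 2 ≤ d) (hq : 1 ≤ q) :
    sInf {x : ℝ | ∃ p : unitInterval, (p : ℝ) = x ∧ FH d q p} - rcCriticalProb d q ≤ (q - 1) / 4 := by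
  have h := csInf_fhSet_le_criticalProb_add hd hq
  have hmono : rcCriticalProb d 1 ≤ rcCriticalProb d q := rcCriticalProb_mono d le_rfl hq
  rw [rcCriticalProb_one_eq_criticalProb] at hmono
  linarith

/-- **`p_FH(2; d) = p_c(2)` under Bodineau's theorem** (`d ≥ 3`; displayed named fact `Bodineau2005_slabThreshold` of
FBN-01, NOT asserted): at `q = 2` the FH-set is exactly `(p_c(2), 1]` (T1s `fh_two_iff_rcCriticalProb_lt`). The Ising
case of binder 1 is thereby calibrated completely, conditionally on that printed theorem. [cite: Bodineau2005, Thm. 1.1; Grimmett2006, Thm. (5.104), Conj. (5.103)] -/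
theorem csInf_fhSet_two_eq_of_bodineau (hB : Bodineau2005_slabThreshold) (hd : 3 ≤ d) :
    sInf {x : ℝ | ∃ p : unitInterval, (p : ℝ) = x ∧ FH d 2 p} = rcCriticalProb d 2 := by
  have h2 : (1 : ℝ) ≤ 2 := by norm_num
  refine le_antisymm (le_of_forall_gt_imp_ge_of_dense fun z hz => ?_) (rcCriticalProb_le_csInf_fhSet (by omega) h2)
  obtain ⟨x, hx, hxz⟩ := exists_between (lt_min hz (rcCriticalProb_lt_one (d := d) (by omega) h2))
  have hx0 : 0 ≤ x := (rcCriticalProb_mem_Icc d 2).1.trans hx.le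
  have hx1 : x ≤ 1 := (hxz.trans_le (min_le_right _ _)).le
  have hFH : FH d 2 ⟨x, hx0, hx1⟩ := (fh_two_iff_rcCriticalProb_lt hB hd).2 hx
  exact (csInf_fhSet_le_of_fh hFH).trans (hxz.le.trans (min_le_left _ _))

/-- **`p_FH` is non-increasing in the dimension**: `2 ≤ d ≤ d' ⟹ p_FH(q; d') ≤ p_FH(q; d)` (`q ≥ 1`; the FH-set
grows with `d`, T1w `fh_of_le_dim`). [cite: Grimmett2006, Thm. (3.21), eq. (3.22); KozmaNitzan2024, §4 Lemma 9 (p. 16)] -/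
theorem csInf_fhSet_anti_dim (hd : 2 ≤ d) {d' : ℕ} (hdd : d ≤ d') (hq : 1 ≤ q) :
    sInf {x : ℝ | ∃ p : unitInterval, (p : ℝ) = x ∧ FH d' q p} ≤
      sInf {x : ℝ | ∃ p : unitInterval, (p : ℝ) = x ∧ FH d q p} := by
  refine csInf_le_csInf (bddBelow_fhSet d' q) (fhSet_nonempty hd hq) ?_
  rintro x ⟨p, rfl, hp⟩
  exact ⟨p, rfl, fh_of_le_dim (by omega) hdd hq hp⟩

end Special

/-! ### 5. K1 at the level of binder 1, and K1 in kernel form for the literal binders of `_r3` -/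

section K1

variable {q : ℝ}

/-- **Binder 1 at every `p ∈ (p_c(q), 1)` ⟺ `p_FH(q; d) = p_c(q)`** (`d ≥ 2`, `q ≥ 1`): since the FH-set is an
up-set containing nothing below `p_c(q)`, "C3a-for-binder-1" is the single equation `p_FH(q; d) = p_c(q)`. (At
`q = 1` it holds, §4; at `q = 2` it holds under Bodineau's theorem; in general it follows from (5.103)_q, next
lemma.) [cite: Grimmett2006, §5.1 eq. (5.3), Conj. (5.103); KozmaNitzan2024, §4 Lemma 9 (p. 16)] -/
theorem forall_fh_iff_csInf_fhSet_eq (hd : 2 ≤ d) (hq : 1 ≤ q) :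
    (∀ p : unitInterval, rcCriticalProb d q < (p : ℝ) → (p : ℝ) < 1 → FH d q p) ↔
      sInf {x : ℝ | ∃ p : unitInterval, (p : ℝ) = x ∧ FH d q p} = rcCriticalProb d q := by
  constructor
  · intro h
    refine le_antisymm (le_of_forall_gt_imp_ge_of_dense fun z hz => ?_) (rcCriticalProb_le_csInf_fhSet hd hq)
    obtain ⟨x, hx, hxz⟩ := exists_between (lt_min hz (rcCriticalProb_lt_one hd hq))
    have hx0 : 0 ≤ x := (rcCriticalProb_mem_Icc d q).1.trans hx.le
    have hx1 : x < 1 := hxz.trans_le (min_le_right _ _)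
    exact (csInf_fhSet_le_of_fh (h ⟨x, hx0, hx1.le⟩ hx hx1)).trans (hxz.le.trans (min_le_left _ _))
  · intro h p hp _
    exact fh_of_csInf_fhSet_lt hd hq (h ▸ hp)

/-- **(5.103)_q ⟹ `p_FH(q; d) = p_c(q)`** (`d ≥ 3`, `q ≥ 1`; displayed hypothesis, in print a theorem for
`q ∈ {1, 2}` only): the K1 interval collapses. [cite: Grimmett2006, §5.7 Conj. (5.103), Thm. (5.104); KozmaNitzan2024, §4 Lemma 9 (p. 16)] -/
theorem csInf_fhSet_eq_of_slabThreshold_eq (hd : 3 ≤ d) (hq : 1 ≤ q)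
    (h5103 : fkSlabCriticalProb d q = rcCriticalProb d q) :
    sInf {x : ℝ | ∃ p : unitInterval, (p : ℝ) = x ∧ FH d q p} = rcCriticalProb d q :=
  le_antisymm (h5103 ▸ csInf_fhSet_le_fkSlabCriticalProb hd hq) (rcCriticalProb_le_csInf_fhSet (by omega) hq)

/-- **K1 IN KERNEL FORM FOR THE LITERAL BINDERS OF THE RECORD** (`d ≥ 3`, `q ≥ 1`): if binder 1 `FH d q p` AND
binder 2 `KNFreeTargetHittable d q p` hold at EVERY `p ∈ (p_c(q), 1)`, then `p̂_c(q) = p_c(q)` — Grimmett's Conjecture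
(5.103) for this `q`. Proof: at such `p` the record `ufsc0_of_freeBoundaryHypothesis_r3` gives `∃ r, UFSC0 d q p r 2⁻³⁴`,
K1-FIN (`fkSlabCriticalProb_le_of_ufsc0`) gives `p̂_c(q) ≤ p`; let `p ↓ p_c(q)`. This is the referee's calibration K1
("[C3a ∀ p > p_c(q)] ∧ C3b ⇒ p̂_c(q) = p_c(q) = GRC Conj (5.103)") with the record's two OPEN binders displayed as
hypotheses: it CONSUMES `_r3`, discharges nothing, and records what discharging both binders above `p_c(q)` would be
worth. [cite: Grimmett2006, §5.7 eq. (5.102), Conj. (5.103); KozmaNitzan2024, §4 Theorem 6, Lemmas 9–10] -/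
theorem slabThreshold_eq_of_forall_fh_targetHittable (hd : 3 ≤ d) (hq : 1 ≤ q)
    (hFH : ∀ p : unitInterval, rcCriticalProb d q < (p : ℝ) → (p : ℝ) < 1 → FH d q p)
    (hTP : ∀ p : unitInterval, rcCriticalProb d q < (p : ℝ) → (p : ℝ) < 1 → KNFreeTargetHittable d q p) :
    fkSlabCriticalProb d q = rcCriticalProb d q := by
  refine le_antisymm (le_of_forall_gt_imp_ge_of_dense fun z hz => ?_)
    (rcCriticalProb_le_fkSlabCriticalProb (by omega) hq)
  obtain ⟨x, hx, hxz⟩ := exists_between (lt_min hz (rcCriticalProb_lt_one (d := d) (by omega) hq))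
  have hx0 : 0 < x := (rcCriticalProb_pos (d := d) (by omega) hq).trans hx
  have hx1 : x < 1 := hxz.trans_le (min_le_right _ _)
  have hε₀ : (0 : ℝ) < (1 / 2) ^ 34 := by positivity
  have hε : 4 * ((1 / 2 : ℝ) ^ 34) ≤ (1 / 2 : ℝ) ^ 32 := by norm_num
  obtain ⟨r, hU⟩ := ufsc0_of_freeBoundaryHypothesis_r3 hd hq hε₀ ⟨x, hx0.le, hx1.le⟩ ⟨hx0, hx1⟩
    (hFH _ hx hx1) (hTP _ hx hx1)
  exact (fkSlabCriticalProb_le_of_ufsc0 hq hε hx0 hU).trans (hxz.le.trans (min_le_left _ _))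

end K1

end Summit.CriticalPhenomena.PercolationContinuityZ3.Theorems.FK
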